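import Mathlib
import HarnessLib
import Literature.MathematicalPhysics.KineticTheory.VelocityFlipNoise
import Summits.AtomisticToContinuum.FouriersLaw.Theorems.VanishingNoiseTransferVanishingNoiseBoundNoisyKuboLink
import Summits.AtomisticToContinuum.FouriersLaw.Theorems.OddSectorIrreversibilityResponseDensityGibbsCutoff
import Summits.AtomisticToContinuum.FouriersLaw.Theorems.VanishingNoiseTransferVanishingNoiseBoundFlipDualKuboIdentity

/-!
# The DUAL Kubo link of the velocity-flip chain: stub S3 from derivative-free forward fields (part 3/3)

`--supports stmt-AtomisticToContinuum-11976` helper file (crux `VanishingNoiseBound`, route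
`VanishingNoiseTransfer`, line `fekete-usc-one-length`, stub S3' `stub_flipForwardFieldRegularity`, wave 4).

* `flip_kuboLink_of_dualForwardFields` — the Kubo link `D_L/(L−1) = γ(1 − (γ/T²)⟨g_0, p_0² − T⟩_{μ_T})` along the
  unique flip-steady family from: a classical `C²` equilibrium forward field `g_0` (`(L_{T,T} + εS) g_0 = −(p_0² − T)`,
  `|g_0| ≤ C e^{H/4T}`), distributional `e^{H/4T}`-bounded forward fields `g_δ` of `L_{T+δ/2,T−δ/2} + εS` with source
  `−(p_0² − T) + μ_δ(p_0² − T)` for `0 < |δ| < δ₀`, and continuity at `δ = 0` (along `δ ≠ 0`) of the two Gibbs pairings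
  `⟨g_δ, p_b² − T⟩_{μ_T}`, `b = 0, L − 1`. Proof: energy balance `totalCurrent(μ_δ) = (L−1)γ(T + δ/2 − ⟨p_0²⟩_δ)`
  (`totalCurrent_eq_left`), the exact dual identity `flip_dualKubo_identity` (part 2, `…FlipDualKuboIdentity`) which
  reads `μ_δ(p_0² − T)/δ = (γ/2T²)(⟨g_δ, k_0⟩ − ⟨g_δ, k_{L−1}⟩)`, uniqueness of limits along `𝓝[≠] 0`, the flip row
  sum `flip_rowSum` (`…FlipKuboDirichlet`). NO derivative of any `g_δ` enters.
* `flip_response_pos_of_dualForwardFields` — hence `0 < D_L` (`flipKubo_pos_and_le`, `…FlipKuboOnsager`).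
* `noisyPositiveConductance_of_dualForwardFields` — **stub S3 VERBATIM behind the derivative-free hypothesis
  `FF''(ε)`**, the corrected form of stub S3' `stub_flipForwardFieldRegularity` (whose `∂_{p_b}`, `∂²_{p_b}` growth
  clauses are the `ε > 0` twin of the OPEN contact-gradient bound `CG` of crux 11749): (i) `C²`-regularity of the
  forward field at EQUILIBRIUM only, with the mild bound `e^{H/4T}` and no growth of derivatives; (ii)–(iv) mild /
  Harris-level clauses near equilibrium (existence of `e^{H/4T}`-bounded distributional forward fields of
  `L_δ + εS`, continuity of two Gibbs pairings at `δ = 0`).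
* `helper_noisyPositiveConductanceOfDualForwardFields` — registered helper (notation-free restatement of
  `flip_response_pos_of_dualForwardFields`).

References: Bonetto–Lebowitz–Rey-Bellet 2000 eq. (32); Rey-Bellet 2003 Rem. 4.4; Bernardin–Olla 2011 §2.1, §6;
Kundu–Dhar–Narayan 2009 (open-system Green–Kubo).
-/

noncomputable section

open MeasureTheory Filter Topology Set ProbabilityTheory
open scoped ContDiff NNReal ENNReal
open Literature.MathematicalPhysics.KineticTheory.HeatConduction
open Literature.MathematicalPhysics.KineticTheory Literature.Probability.Process OscillatorChain
open Summit.AtomisticToContinuum.FouriersLaw.Theorems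
open Summit.AtomisticToContinuum.FouriersLaw.Theorems.SubdiffusiveBondHeat (abs_sq_momentum_sub_le_exp integrable_of_abs_le_exp)
open Summit.AtomisticToContinuum.FouriersLaw.Cruxes.SuperadditiveResistance.FloatingProbeBypassLaplacian
  (pinnedChain_memLp_two_snd pinnedChain_integral_snd_sq)
open Summit.AtomisticToContinuum.FouriersLaw.Theorems.SuperadditiveResistance.DeviceLiouville (kin kin_eq_sq)
open Summit.AtomisticToContinuum.FouriersLaw.Cruxes.ConductanceLowerBound.ForecastSensitivity (memLp_two_of_abs_le_exp)

namespace Summit.AtomisticToContinuum.FouriersLaw.Theorems.VanishingNoiseBound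

/-! ## The Kubo link from dual forward fields -/

section Link

variable {ω₂ lam β γ : ℝ}

/-- **The Kubo link of the flip chain from DUAL forward fields** (mixing-free AND derivative-free). Along the
unique flip-steady family `μ` of the pinned anharmonic chain (all parameters `> 0`, `T > 0`, `ε > 0`) with response
coefficient `D_L` at `T`, `L ≥ 2`: suppose `g : ℝ → (PhaseSpace L → ℝ)` is such that `g 0` is a classical `C²`
forward field of `L_{T,T} + εS` (`(L_{T,T} + εS)(g 0) = −(p_0² − T)`, `|g 0| ≤ C e^{H/4T}`), that for
`0 < |δ| < δ₀` the function `g δ` is measurable, `e^{H/4T}`-bounded and solves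
`(L_{T+δ/2,T−δ/2} + εS)(g δ) = −(p_0² − T) + μ_δ(p_0² − T)` in `𝓓'`, and that the two Gibbs pairings
`⟨g δ, p_b² − T⟩_{μ_T}` (`b = 0, L − 1`) are continuous at `δ = 0` along `δ ≠ 0`. Then
`D_L/(L−1) = γ(1 − (γ/T²)⟨g 0, p_0² − T⟩_{μ_T})`. Proof: energy balance
`totalCurrent(μ_δ) = (L−1)γ(T + δ/2 − ⟨p_0²⟩_δ)`; the dual identity `flip_dualKubo_identity` at
`(T_L, T_R) = (T ± δ/2)`, which reads `μ_δ(p_0² − T)/δ = (γ/2T²)(⟨g δ, k_0⟩ − ⟨g δ, k_{L−1}⟩)`; the limit `δ → 0`;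
the flip row sum `flip_rowSum`. -/
theorem flip_kuboLink_of_dualForwardFields
    (μ : (N : ℕ) → ℝ → ℝ → Measure (PhaseSpace N)) {T ε : ℝ} (D : ℕ → ℝ)
    (hω : 0 < ω₂) (hl : 0 < lam) (hβ : 0 < β) (hγ : 0 < γ) (hT : 0 < T) (hε : 0 < ε)
    (hμ : ∀ (N : ℕ) (T_L T_R : ℝ), 0 < T_L → 0 < T_R →
      (pinnedChain ω₂ lam β γ).IsFlipSteadyState N T_L T_R ε (μ N T_L T_R) ∧
        ∀ ν : Measure (PhaseSpace N), (pinnedChain ω₂ lam β γ).IsFlipSteadyState N T_L T_R ε ν → ν = μ N T_L T_R)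
    {L : ℕ} (hL2 : 2 ≤ L)
    (hD : Tendsto (fun δ : ℝ =>
        (pinnedChain ω₂ lam β γ).totalCurrent (μ L (T + δ / 2) (T - δ / 2)) / δ) (𝓝[≠] 0) (𝓝 (D L)))
    (g : ℝ → PhaseSpace L → ℝ) {δ₀ : ℝ} (hδ₀ : 0 < δ₀)
    (hmeas : ∀ δ, 0 < |δ| → |δ| < δ₀ → AEStronglyMeasurable (g δ) volume)
    (hbd : ∀ δ, 0 < |δ| → |δ| < δ₀ →
      ∃ C : ℝ, ∀ x, |g δ x| ≤ C * Real.exp (1 / (4 * T) * (pinnedChain ω₂ lam β γ).hamiltonian L x))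
    (hweak : ∀ δ, 0 < |δ| → |δ| < δ₀ → ∀ φ : PhaseSpace L → ℝ, ContDiff ℝ ((⊤ : ℕ∞) : WithTop ℕ∞) φ →
      HasCompactSupport φ →
      ∫ x, g δ x * (-((pinnedChain ω₂ lam β γ).generator L (T + δ / 2) (T - δ / 2) φ x) +
          2 * γ * ((T + δ / 2) * partialP (⟨0, by omega⟩ : Fin L) (partialP (⟨0, by omega⟩ : Fin L) φ) x +
            (T - δ / 2) * partialP (⟨L - 1, by omega⟩ : Fin L) (partialP (⟨L - 1, by omega⟩ : Fin L) φ) x) +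
          2 * γ * φ x + ε * flipNoise L φ x) =
        ∫ x, (-(kin L 0 x - T) + ∫ y, (kin L 0 y - T) ∂(μ L (T + δ / 2) (T - δ / 2))) * φ x)
    (hlim0 : Tendsto (fun δ => ∫ x, g δ x * (kin L 0 x - T) ∂((pinnedChain ω₂ lam β γ).gibbsMeasure L T))
      (𝓝[≠] 0) (𝓝 (∫ x, g 0 x * (kin L 0 x - T) ∂((pinnedChain ω₂ lam β γ).gibbsMeasure L T))))
    (hlim1 : Tendsto (fun δ => ∫ x, g δ x * (kin L (L - 1) x - T) ∂((pinnedChain ω₂ lam β γ).gibbsMeasure L T))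
      (𝓝[≠] 0) (𝓝 (∫ x, g 0 x * (kin L (L - 1) x - T) ∂((pinnedChain ω₂ lam β γ).gibbsMeasure L T))))
    (hC : ContDiff ℝ 2 (g 0)) {C₀ : ℝ}
    (hgb0 : ∀ x, |g 0 x| ≤ C₀ * Real.exp (1 / (4 * T) * (pinnedChain ω₂ lam β γ).hamiltonian L x))
    (hpde : ∀ x, (pinnedChain ω₂ lam β γ).flipGenerator L T T ε (g 0) x = -(kin L 0 x - T)) :
    D L / ((L : ℝ) - 1) =
      γ * (1 - γ / T ^ 2 * ∫ x, g 0 x * (kin L 0 x - T) ∂((pinnedChain ω₂ lam β γ).gibbsMeasure L T)) := by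
  have hL : 0 < L := by omega
  set P := pinnedChain ω₂ lam β γ with hP
  set μT := P.gibbsMeasure L T with hμT
  haveI : IsProbabilityMeasure μT := pinnedChain_isProbabilityMeasure_gibbsMeasure hω hl.le hβ.le γ L hT
  set i0 : Fin L := ⟨0, hL⟩ with hi0
  set H : PhaseSpace L → ℝ := P.hamiltonian L with hH
  set A : ℝ := ∫ x, g 0 x * (kin L 0 x - T) ∂μT with hA
  set B : ℝ := ∫ x, g 0 x * (kin L (L - 1) x - T) ∂μT with hB
  set μf : ℝ → Measure (PhaseSpace L) := fun δ => μ L (T + δ / 2) (T - δ / 2) with hμf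
  set k : PhaseSpace L → ℝ := fun y => y.2 i0 ^ 2 - T with hk
  have hkc : Continuous k := by rw [hk]; fun_prop
  have hkeq : ∀ ν : Measure (PhaseSpace L), ∫ y, (kin L 0 y - T) ∂ν = ∫ y, k y ∂ν := fun ν =>
    integral_congr_ae (ae_of_all _ fun y => by simp only [hk, hi0, kin_eq_sq hL y])
  have h14 : 1 / (4 * T) < 1 / T := by rw [div_lt_div_iff₀ (by positivity) hT]; nlinarith
  have h14' : 2 * (1 / (4 * T)) < 1 / T := by
    rw [show 2 * (1 / (4 * T)) = 1 / (2 * T) by field_simp; ring, div_lt_div_iff₀ (by positivity) hT]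
    nlinarith
  have h1423 : 1 / (4 * T) < 2 / (3 * T) := by rw [div_lt_div_iff₀ (by positivity) (by positivity)]; nlinarith
  have h140 : 0 < 1 / (4 * T) := by positivity
  -- (1) the dual identity: `μ_δ(k_0)/δ = (γ/2T²)(⟨g δ, k_0⟩ − ⟨g δ, k_{L−1}⟩)` for `0 < |δ| < δ₀`
  have hstat : ∀ δ : ℝ, 0 < |δ| → |δ| < δ₀ →
      (∫ y, k y ∂(μf δ)) / δ = γ / (2 * T ^ 2) * ((∫ x, g δ x * (kin L 0 x - T) ∂μT) -
        ∫ x, g δ x * (kin L (L - 1) x - T) ∂μT) := by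
    intro δ hδ0 hδ
    obtain ⟨C, hCb⟩ := hbd δ hδ0 hδ
    have hid := flip_dualKubo_identity hω hl.le hβ.le hL2 hT (T + δ / 2) (T - δ / 2) ε
      (∫ y, (kin L 0 y - T) ∂(μf δ)) (hmeas δ hδ0 hδ) h14 hCb (hweak δ hδ0 hδ)
    have hδne : δ ≠ 0 := abs_pos.mp hδ0
    rw [← hkeq, hid]
    field_simp
    ring
  -- (2) the limit `δ → 0`
  have hlimk : Tendsto (fun δ : ℝ => (∫ y, k y ∂(μf δ)) / δ) (𝓝[≠] 0) (𝓝 (γ / (2 * T ^ 2) * (A - B))) := by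
    have h := (hlim0.sub hlim1).const_mul (γ / (2 * T ^ 2))
    refine h.congr' ?_
    have hball : ∀ᶠ δ in 𝓝 (0 : ℝ), |δ| < δ₀ := by
      have : Metric.ball (0 : ℝ) δ₀ ∈ 𝓝 (0 : ℝ) := Metric.ball_mem_nhds 0 hδ₀
      filter_upwards [this] with δ hδ
      simpa [Real.dist_eq] using hδ
    filter_upwards [hball.filter_mono nhdsWithin_le_nhds, self_mem_nhdsWithin] with δ hδ hδ0
    rw [Set.mem_compl_iff, Set.mem_singleton_iff] at hδ0
    exact (hstat δ (abs_pos.mpr hδ0) hδ).symm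
  -- (3) energy balance `totalCurrent(μ_δ)/δ = (L−1)γ(1/2 − μ_δ(k_0)/δ)` for `0 < |δ| < T`
  have hballT : ∀ᶠ δ in 𝓝 (0 : ℝ), |δ| < T := by
    have : Metric.ball (0 : ℝ) T ∈ 𝓝 (0 : ℝ) := Metric.ball_mem_nhds 0 hT
    filter_upwards [this] with δ hδ
    simpa [Real.dist_eq] using hδ
  have hbal : ∀ᶠ δ in 𝓝[≠] (0 : ℝ),
      ((L : ℝ) - 1) * γ * (1 / 2 - (∫ y, k y ∂(μf δ)) / δ) = P.totalCurrent (μf δ) / δ := by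
    filter_upwards [hballT.filter_mono nhdsWithin_le_nhds, self_mem_nhdsWithin] with δ hδ hδ0
    rw [Set.mem_compl_iff, Set.mem_singleton_iff] at hδ0
    have hδ1 := abs_lt.1 hδ
    have hTL : 0 < T + δ / 2 := by linarith
    have hTR : 0 < T - δ / 2 := by linarith
    have hfam := hμ L _ _ hTL hTR
    haveI : IsProbabilityMeasure (μf δ) := hfam.1.isProbabilityMeasure
    have htc := VanishingNoiseBound.totalCurrent_eq_left hω hl.le hβ.le hγ hL hTL.le hTR.le hfam.1
    have hexps : Integrable (fun x => Real.exp (1 / (4 * T) * H x)) (μf δ) :=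
      integrable_exp_of_unique hω hl hβ hγ hTL hTR hε hfam h140 (h1423.trans (two_div_lt_inv_max hT hδ))
    have hkint : Integrable k (μf δ) :=
      integrable_of_abs_le_exp hexps hkc fun x => abs_sq_momentum_sub_le_exp (γ := γ) hω hl.le hβ.le h140 hT.le x i0
    have hp2 : ∫ x, x.2 ⟨0, hL⟩ ^ 2 ∂(μf δ) = (∫ y, k y ∂(μf δ)) + T := by
      have e : (fun x : PhaseSpace L => x.2 ⟨0, hL⟩ ^ 2) = fun x => k x + T := by
        funext x; simp [hk, hi0]
      rw [e, integral_add hkint (integrable_const T), integral_const, probReal_univ, one_smul]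
    rw [htc, hp2]
    field_simp
    ring
  have hlimJ : Tendsto (fun δ : ℝ => P.totalCurrent (μf δ) / δ) (𝓝[≠] 0)
      (𝓝 (((L : ℝ) - 1) * γ * (1 / 2 - γ / (2 * T ^ 2) * (A - B)))) :=
    ((hlimk.const_sub (1 / 2)).const_mul (((L : ℝ) - 1) * γ)).congr' hbal
  have hDL : D L = ((L : ℝ) - 1) * γ * (1 / 2 - γ / (2 * T ^ 2) * (A - B)) := tendsto_nhds_unique hD hlimJ
  -- (4) the row sum and the algebra
  have hgL2 : MemLp (g 0) 2 μT := memLp_two_of_abs_le_exp hω hl.le hβ.le γ L hT h14' hC.continuous hgb0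
  have hrow : A + B = T ^ 2 / γ := flip_rowSum hω hl hβ hγ hT ε hL2 hC hgL2 hpde
  have hBeq : B = T ^ 2 / γ - A := by linarith
  have hL1r : ((L : ℝ) - 1) ≠ 0 := by
    have : (2 : ℝ) ≤ (L : ℝ) := by exact_mod_cast hL2
    linarith
  have hT0 : T ≠ 0 := hT.ne'
  rw [hDL, hBeq]
  field_simp
  ring

/-- **Positivity of the flip-noisy response from dual forward fields**: under the hypotheses of
`flip_kuboLink_of_dualForwardFields`, `0 < D_L` (the Onsager sign `flipKubo_pos_and_le`). -/
theorem flip_response_pos_of_dualForwardFields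
    (μ : (N : ℕ) → ℝ → ℝ → Measure (PhaseSpace N)) {T ε : ℝ} (D : ℕ → ℝ)
    (hω : 0 < ω₂) (hl : 0 < lam) (hβ : 0 < β) (hγ : 0 < γ) (hT : 0 < T) (hε : 0 < ε)
    (hμ : ∀ (N : ℕ) (T_L T_R : ℝ), 0 < T_L → 0 < T_R →
      (pinnedChain ω₂ lam β γ).IsFlipSteadyState N T_L T_R ε (μ N T_L T_R) ∧
        ∀ ν : Measure (PhaseSpace N), (pinnedChain ω₂ lam β γ).IsFlipSteadyState N T_L T_R ε ν → ν = μ N T_L T_R)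
    {L : ℕ} (hL2 : 2 ≤ L)
    (hD : Tendsto (fun δ : ℝ =>
        (pinnedChain ω₂ lam β γ).totalCurrent (μ L (T + δ / 2) (T - δ / 2)) / δ) (𝓝[≠] 0) (𝓝 (D L)))
    (g : ℝ → PhaseSpace L → ℝ) {δ₀ : ℝ} (hδ₀ : 0 < δ₀)
    (hmeas : ∀ δ, 0 < |δ| → |δ| < δ₀ → AEStronglyMeasurable (g δ) volume)
    (hbd : ∀ δ, 0 < |δ| → |δ| < δ₀ →
      ∃ C : ℝ, ∀ x, |g δ x| ≤ C * Real.exp (1 / (4 * T) * (pinnedChain ω₂ lam β γ).hamiltonian L x))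
    (hweak : ∀ δ, 0 < |δ| → |δ| < δ₀ → ∀ φ : PhaseSpace L → ℝ, ContDiff ℝ ((⊤ : ℕ∞) : WithTop ℕ∞) φ →
      HasCompactSupport φ →
      ∫ x, g δ x * (-((pinnedChain ω₂ lam β γ).generator L (T + δ / 2) (T - δ / 2) φ x) +
          2 * γ * ((T + δ / 2) * partialP (⟨0, by omega⟩ : Fin L) (partialP (⟨0, by omega⟩ : Fin L) φ) x +
            (T - δ / 2) * partialP (⟨L - 1, by omega⟩ : Fin L) (partialP (⟨L - 1, by omega⟩ : Fin L) φ) x) +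
          2 * γ * φ x + ε * flipNoise L φ x) =
        ∫ x, (-(kin L 0 x - T) + ∫ y, (kin L 0 y - T) ∂(μ L (T + δ / 2) (T - δ / 2))) * φ x)
    (hlim0 : Tendsto (fun δ => ∫ x, g δ x * (kin L 0 x - T) ∂((pinnedChain ω₂ lam β γ).gibbsMeasure L T))
      (𝓝[≠] 0) (𝓝 (∫ x, g 0 x * (kin L 0 x - T) ∂((pinnedChain ω₂ lam β γ).gibbsMeasure L T))))
    (hlim1 : Tendsto (fun δ => ∫ x, g δ x * (kin L (L - 1) x - T) ∂((pinnedChain ω₂ lam β γ).gibbsMeasure L T))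
      (𝓝[≠] 0) (𝓝 (∫ x, g 0 x * (kin L (L - 1) x - T) ∂((pinnedChain ω₂ lam β γ).gibbsMeasure L T))))
    (hC : ContDiff ℝ 2 (g 0)) {C₀ : ℝ}
    (hgb0 : ∀ x, |g 0 x| ≤ C₀ * Real.exp (1 / (4 * T) * (pinnedChain ω₂ lam β γ).hamiltonian L x))
    (hpde : ∀ x, (pinnedChain ω₂ lam β γ).flipGenerator L T T ε (g 0) x = -(kin L 0 x - T)) :
    0 < D L := by
  have hlink := flip_kuboLink_of_dualForwardFields μ D hω hl hβ hγ hT hε hμ hL2 hD g hδ₀ hmeas hbd hweak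
    hlim0 hlim1 hC hgb0 hpde
  have h14' : 2 * (1 / (4 * T)) < 1 / T := by
    rw [show 2 * (1 / (4 * T)) = 1 / (2 * T) by field_simp; ring, div_lt_div_iff₀ (by positivity) hT]
    nlinarith
  have hgL2 : MemLp (g 0) 2 ((pinnedChain ω₂ lam β γ).gibbsMeasure L T) :=
    memLp_two_of_abs_le_exp hω hl.le hβ.le γ L hT h14' hC.continuous hgb0
  have hpos := (flipKubo_pos_and_le hω hl hβ hγ hT hε.le hL2 hC hgL2 hpde).1
  rw [← hlink] at hpos
  have hL1r : 0 < ((L : ℝ) - 1) := by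
    have : (2 : ℝ) ≤ (L : ℝ) := by exact_mod_cast hL2
    linarith
  have := mul_pos hpos hL1r
  rwa [div_mul_cancel₀ _ hL1r.ne'] at this

end Link

/-! ## Stub S3 behind the derivative-free hypothesis `FF''(ε)` -/

/-- **Stub S3 `stub_noisyPositiveConductance` VERBATIM behind the derivative-free hypothesis `FF''(ε)`**, the
corrected form of stub S3' `stub_flipForwardFieldRegularity`: for all admissible parameters, `T > 0`, `ε > 0`, along
every flip-steady family `μ` unique in its class, and every `L ≥ 2`, there are `g : ℝ → (PhaseSpace L → ℝ)` and
`δ₀ > 0` with (i) `g 0 ∈ C²`, `(L_{T,T} + εS)(g 0) = −(p_0² − T)` pointwise; (ii) `|g δ| ≤ C_δ e^{H/4T}` for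
`|δ| < δ₀`; (iii) for `0 < |δ| < δ₀`, `g δ` measurable and `(L_{T+δ/2,T−δ/2} + εS)(g δ) = −(p_0² − T) + μ_δ(p_0² − T)`
in `𝓓'` (tested through the transpose `−L + 2γ(T_L∂²_{p_0} + T_R∂²_{p_{L−1}}) + 2γ + εS`); (iv) continuity at
`δ = 0` along `δ ≠ 0` of `⟨g δ, p_0² − T⟩_{μ_T}` and `⟨g δ, p_{L−1}² − T⟩_{μ_T}`. Then `D_N(ε) > 0` for `N ≥ 2`
(`flip_response_pos_of_dualForwardFields`). Clause (i) is hypoelliptic `C²`-regularity of the mild forward field at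
EQUILIBRIUM (no growth of derivatives); (ii)–(iv) are Harris-level statements about mild forward fields near
equilibrium. -/
theorem noisyPositiveConductance_of_dualForwardFields :
    (∀ (ω₂ lam β γ T ε : ℝ), 0 < ω₂ → 0 < lam → 0 < β → 0 < γ → 0 < T → 0 < ε →
      ∀ μ : (N : ℕ) → ℝ → ℝ → Measure (PhaseSpace N),
        (∀ (N : ℕ) (T_L T_R : ℝ), 0 < T_L → 0 < T_R →
          (pinnedChain ω₂ lam β γ).IsFlipSteadyState N T_L T_R ε (μ N T_L T_R) ∧
            ∀ ν : Measure (PhaseSpace N),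
              (pinnedChain ω₂ lam β γ).IsFlipSteadyState N T_L T_R ε ν → ν = μ N T_L T_R) →
        ∀ (L : ℕ) (hL : 2 ≤ L),
          ∃ (g : ℝ → PhaseSpace L → ℝ) (δ₀ : ℝ), 0 < δ₀ ∧
            ContDiff ℝ 2 (g 0) ∧
            (∀ x, (pinnedChain ω₂ lam β γ).flipGenerator L T T ε (g 0) x = -(kin L 0 x - T)) ∧
            (∀ δ, |δ| < δ₀ → ∃ C : ℝ, ∀ x,
              |g δ x| ≤ C * Real.exp (1 / (4 * T) * (pinnedChain ω₂ lam β γ).hamiltonian L x)) ∧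
            (∀ δ, 0 < |δ| → |δ| < δ₀ → Measurable (g δ) ∧
              ∀ φ : PhaseSpace L → ℝ, ContDiff ℝ ((⊤ : ℕ∞) : WithTop ℕ∞) φ → HasCompactSupport φ →
                ∫ x, g δ x * (-((pinnedChain ω₂ lam β γ).generator L (T + δ / 2) (T - δ / 2) φ x) +
                    2 * γ * ((T + δ / 2) * partialP (⟨0, by omega⟩ : Fin L) (partialP (⟨0, by omega⟩ : Fin L) φ) x +
                      (T - δ / 2) * partialP (⟨L - 1, by omega⟩ : Fin L)
                        (partialP (⟨L - 1, by omega⟩ : Fin L) φ) x) +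
                    2 * γ * φ x + ε * flipNoise L φ x) =
                  ∫ x, (-(kin L 0 x - T) + ∫ y, (kin L 0 y - T) ∂(μ L (T + δ / 2) (T - δ / 2))) * φ x) ∧
            Tendsto (fun δ => ∫ x, g δ x * (kin L 0 x - T) ∂((pinnedChain ω₂ lam β γ).gibbsMeasure L T))
              (𝓝[≠] 0) (𝓝 (∫ x, g 0 x * (kin L 0 x - T) ∂((pinnedChain ω₂ lam β γ).gibbsMeasure L T))) ∧
            Tendsto (fun δ => ∫ x, g δ x * (kin L (L - 1) x - T) ∂((pinnedChain ω₂ lam β γ).gibbsMeasure L T))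
              (𝓝[≠] 0) (𝓝 (∫ x, g 0 x * (kin L (L - 1) x - T) ∂((pinnedChain ω₂ lam β γ).gibbsMeasure L T)))) →
    ∀ ω₂ lam β γ : ℝ, 0 < ω₂ → 0 < lam → 0 < β → 0 < γ → ∀ T : ℝ, 0 < T → ∀ ε : ℝ, 0 < ε →
      ∀ μ : (N : ℕ) → ℝ → ℝ → Measure (PhaseSpace N),
        (∀ (N : ℕ) (T_L T_R : ℝ), 0 < T_L → 0 < T_R →
          (pinnedChain ω₂ lam β γ).IsFlipSteadyState N T_L T_R ε (μ N T_L T_R) ∧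
            ∀ ν : Measure (PhaseSpace N),
              (pinnedChain ω₂ lam β γ).IsFlipSteadyState N T_L T_R ε ν → ν = μ N T_L T_R) →
        ∀ D : ℕ → ℝ,
          (∀ N : ℕ, Tendsto (fun δ : ℝ =>
            (pinnedChain ω₂ lam β γ).totalCurrent (μ N (T + δ / 2) (T - δ / 2)) / δ)
            (𝓝[≠] 0) (𝓝 (D N))) →
          ∀ N : ℕ, 2 ≤ N → 0 < D N := by
  intro hFF ω₂ lam β γ hω hl hβ hγ T hT ε hε μ hμ D hD N hN
  obtain ⟨g, δ₀, hδ₀, hC, hpde, hbd, hweak, hlim0, hlim1⟩ := hFF ω₂ lam β γ T ε hω hl hβ hγ hT hε μ hμ N hN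
  obtain ⟨C₀, hgb0⟩ := hbd 0 (by simpa using hδ₀)
  exact flip_response_pos_of_dualForwardFields μ D hω hl hβ hγ hT hε hμ hN (hD N) g hδ₀
    (fun δ h0 h1 => ((hweak δ h0 h1).1).aestronglyMeasurable) (fun δ _ h1 => hbd δ h1)
    (fun δ h0 h1 => (hweak δ h0 h1).2) hlim0 hlim1 hC hgb0 hpde

/-! ## Registered helper -/

/-- Registered helper sub-goal `helper_noisyPositiveConductanceOfDualForwardFields` of stub
`stub_flipForwardFieldRegularity` (line `fekete-usc-one-length`, crux stmt-AtomisticToContinuum-11976): `0 < D_L(ε)`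
along the unique flip-steady family from DUAL (derivative-free) forward fields — the hypotheses of one instance of
`FF''(ε)` (`flip_response_pos_of_dualForwardFields`). -/
theorem helper_noisyPositiveConductanceOfDualForwardFields : ∀ (ω₂ lam β γ : ℝ) (μ : (N : ℕ) → ℝ → ℝ → MeasureTheory.Measure (Literature.MathematicalPhysics.KineticTheory.HeatConduction.PhaseSpace N)) (T ε : ℝ) (D : ℕ → ℝ), 0 < ω₂ → 0 < lam → 0 < β → 0 < γ → 0 < T → 0 < ε → (∀ (N : ℕ) (T_L T_R : ℝ), 0 < T_L → 0 < T_R → (Literature.MathematicalPhysics.KineticTheory.HeatConduction.pinnedChain ω₂ lam β γ).IsFlipSteadyState N T_L T_R ε (μ N T_L T_R) ∧ ∀ ν : MeasureTheory.Measure (Literature.MathematicalPhysics.KineticTheory.HeatConduction.PhaseSpace N), (Literature.MathematicalPhysics.KineticTheory.HeatConduction.pinnedChain ω₂ lam β γ).IsFlipSteadyState N T_L T_R ε ν → ν = μ N T_L T_R) → ∀ (L : ℕ) (hL : 2 ≤ L), Filter.Tendsto (fun δ => (Literature.MathematicalPhysics.KineticTheory.HeatConduction.pinnedChain ω₂ lam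 β γ).totalCurrent (μ L (T + δ / 2) (T - δ / 2)) / δ) (nhdsWithin 0 {(0 : ℝ)}ᶜ) (nhds (D L)) → ∀ (g : ℝ → Literature.MathematicalPhysics.KineticTheory.HeatConduction.PhaseSpace L → ℝ) (δ₀ : ℝ), 0 < δ₀ → (∀ δ, 0 < |δ| → |δ| < δ₀ → Measurable (g δ)) → (∀ δ, |δ| < δ₀ → ∃ C : ℝ, ∀ x, |g δ x| ≤ C * Real.exp (1 / (4 * T) * (Literature.MathematicalPhysics.KineticTheory.HeatConduction.pinnedChain ω₂ lam β γ).hamiltonian L x)) → (∀ δ, 0 < |δ| → |δ| < δ₀ → ∀ φ : Literature.MathematicalPhysics.KineticTheory.HeatConduction.PhaseSpace L → ℝ, ContDiff ℝ ((⊤ : ℕ∞) : WithTop ℕ∞) φ → HasCompactSupport φ → MeasureTheory.integral MeasureTheory.volume (fun x => g δ x * (-((Literature.MathematicalPhysics.KineticTheory.HeatConduction.pinnedChain ω₂ lam β γ).generator L (T + δ / 2) (T - δ / 2) φ x) + 2 * γ * ((T + δ / 2) * Literature.MathematicalPhysics.KineticTheory.HeatConduction.partialP (⟨0, by omega⟩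 : Fin L) (Literature.MathematicalPhysics.KineticTheory.HeatConduction.partialP (⟨0, by omega⟩ : Fin L) φ) x + (T - δ / 2) * Literature.MathematicalPhysics.KineticTheory.HeatConduction.partialP (⟨L - 1, by omega⟩ : Fin L) (Literature.MathematicalPhysics.KineticTheory.HeatConduction.partialP (⟨L - 1, by omega⟩ : Fin L) φ) x) + 2 * γ * φ x + ε * Literature.MathematicalPhysics.KineticTheory.HeatConduction.flipNoise L φ x)) = MeasureTheory.integral MeasureTheory.volume (fun x => (-(Summit.AtomisticToContinuum.FouriersLaw.Theorems.SuperadditiveResistance.DeviceLiouville.kin L 0 x - T) + MeasureTheory.integral (μ L (T + δ / 2) (T - δ / 2)) (fun y => Summit.AtomisticToContinuum.FouriersLaw.Theorems.SuperadditiveResistance.DeviceLiouville.kin L 0 y - T)) * φ x)) → Filter.Tendsto (fun δ => MeasureTheory.integral ((Literature.MathematicalPhysics.KineticTheory.HeatConduction.pinnedChain ω₂ lam β γ).gibbsMeasure L T) (fun x => g δ x * (Summit.AtomisticToContinuum.FouriersLaw.Theorems.SuperadditiveResistance.DeviceLiouville.kin L 0 x - T))) (nhdsWithin 0 {(0 :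 ℝ)}ᶜ) (nhds (MeasureTheory.integral ((Literature.MathematicalPhysics.KineticTheory.HeatConduction.pinnedChain ω₂ lam β γ).gibbsMeasure L T) (fun x => g 0 x * (Summit.AtomisticToContinuum.FouriersLaw.Theorems.SuperadditiveResistance.DeviceLiouville.kin L 0 x - T)))) → Filter.Tendsto (fun δ => MeasureTheory.integral ((Literature.MathematicalPhysics.KineticTheory.HeatConduction.pinnedChain ω₂ lam β γ).gibbsMeasure L T) (fun x => g δ x * (Summit.AtomisticToContinuum.FouriersLaw.Theorems.SuperadditiveResistance.DeviceLiouville.kin L (L - 1) x - T))) (nhdsWithin 0 {(0 : ℝ)}ᶜ) (nhds (MeasureTheory.integral ((Literature.MathematicalPhysics.KineticTheory.HeatConduction.pinnedChain ω₂ lam β γ).gibbsMeasure L T) (fun x => g 0 x * (Summit.AtomisticToContinuum.FouriersLaw.Theorems.SuperadditiveResistance.DeviceLiouville.kin L (L - 1) x - T)))) → ContDiff ℝ 2 (g 0) → (∀ x, (Literature.MathematicalPhysics.KineticTheory.HeatConduction.pinnedChain ω₂ lam β γ).flipGenerator L T T ε (g 0) x = -(Summit.AtomisticToContinuum.FouriersLaw.Theorems.SuperadditiveResistance.DeviceLiouville.kin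 L 0 x - T)) → 0 < D L :=
  fun _ _ _ _ μ _ _ D hω hl hβ hγ hT hε hμ _ hL hD g _ hδ₀ hmeas hbd hweak hlim0 hlim1 hC hpde => by
    obtain ⟨C₀, hgb0⟩ := hbd 0 (by simpa using hδ₀)
    exact flip_response_pos_of_dualForwardFields μ D hω hl hβ hγ hT hε hμ hL hD g hδ₀
      (fun δ h0 h1 => (hmeas δ h0 h1).aestronglyMeasurable) (fun δ _ h1 => hbd δ h1) hweak hlim0 hlim1 hC hgb0 hpde

end Summit.AtomisticToContinuum.FouriersLaw.Theorems.VanishingNoiseBound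

end
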